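import Literature.NumberTheory.Automorphic.UnitaryGroupTruncatedKernelClassOffBorel
import Literature.NumberTheory.Automorphic.UnitaryGroupKernelDictionary
import Literature.NumberTheory.Automorphic.UnitaryGroupDiagTraceNormalized
import Literature.NumberTheory.Automorphic.AutomorphicQuotientKernelGeometric
import Literature.MeasureTheory.Group.InvariantQuotientNormalizedSubset
import HarnessLib

/-!
# The elliptic terms of Arthur's truncated trace for the quasi-split unitary group are orbital
# integrals with covolume weights:
# `J^T_𝔬(f) = c_μ · Σ_{[γ] ⊆ 𝔬} vol(G_γ(F)\G_γ(𝔸_F)) · Φ_{ν/ν_γ}(γ, f)`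
(Rogawski, *Automorphic Representations of Unitary Groups in Three Variables* (1990), §2.2–2.3 pp. 13–14:
the elliptic terms `J_𝔬(f)` of the `𝔬`-expansion; Arthur, Duke Math. J. 45 (1978), §8; Gelbart (1975),
(9.12)–(9.13), Thm. 9.22 (ii), Remark 9.23 for the unfolding with the printed volumes)

Topic `NumberTheory/Automorphic`; namespace `Literature.NumberTheory.Automorphic.UnitaryGroup`. THEOREMS
ONLY (no definition, no named fact, no instance, no notation, no attribute, no `sorry`) over accepted modules,
for the quasi-split datum `quasiSplit F E c N` (`A_G = 1`, ★ `quotientSubgroup_quasiSplit`), a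
conjugation-invariant class map `cl : G(F) → ι` (★ `IsConjInvariant`) and a class `𝔬 = cl⁻¹ {i}`:

* §1 DICTIONARY. `conj_mem_image_fiber` (the fibre `{γ ∈ G(F) | cl γ = 𝔬} ⊆ G(𝔸_F)` is stable under
  `G(F)`-conjugation — the `hS` slot of ★ `conjTsum`); `quotFun_kernelClass_diag_toAutomorphicQuotient`
  (`quotFun K_𝔬 [g] = K_𝔬(g⁻¹, g⁻¹) = Σ'_{γ ∈ 𝔬} f(g γ g⁻¹)`); **`quotFun_kernelClass_diag_eq_conjTsum`** —
  the descended diagonal class kernel `[g] ↦ K_𝔬(g⁻¹, g⁻¹)` of ★ `UnitaryGroupArthurKernelClassExpansion` IS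
  the sum over conjugates `conjTsum G(F) {γ | cl γ = 𝔬} f` of the generic engine ★ `InvariantQuotientConjugacySum`.
* §2 STRUCTURE. `discreteTopology_quotientSubgroup_quasiSplit`, `isHaarMeasure_count_quotientSubgroup_quasiSplit`,
  `isHaarMeasure_count_inf_centralizer_subgroupOf_quasiSplit` (the counting measures on the discrete `G(F)`,
  `G(F)_γ` are Haar measures — dischargers of the binders below).
* §3 **`lintegral_conjTsum_fiber_eq_mul_tsum_covol_mul`** — `[0, ∞]`-valued unfolding of ONE class over
  `X = G(𝔸_F) ⧸ G(F)`: for an invariant `μ ≠ 0` finite on compacta, a Haar measure `ν` (two-sided), a section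
  `rep` of the conjugacy classes of `G(F)`, Haar measures `ν_s` on the adelic centralisers `G_{γ_s}`
  (`γ_s = rep s`, two-sided and inversion invariant) and — the ONE geometric input, (L4-b)
  ★ `compactSpace_centralizer_quotient_of_forall_cl_ne` at elliptic classes — `G_{γ_s} ⧸ G(F)_{γ_s}` compact for
  the classes `s ⊆ 𝔬`:
  `∫_X Σ'_{γ ∈ 𝔬} Φ(x̃ γ x̃⁻¹) dμ = c_μ · Σ'_{s ⊆ 𝔬} vol(G_{γ_s} ⧸ G(F)_{γ_s}) · ∫_{G(𝔸) ⧸ G_{γ_s}} Φ(y γ_s y⁻¹) d(ν/ν_s)`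
  for Borel `Φ ≥ 0`, `c_μ = unfoldingConstant G(F) count μ ν` (Weil's constant; `= 1` for `μ = ν/count`),
  `vol = quotientMeasure (G(F)_{γ_s} ≤ G_{γ_s}) count ν_s (univ)` (★ `lintegral_conjTsum_subset_eq_mul_tsum_covol_mul`).
* §4 **`integral_conjTsum_fiber_eq_mul_tsum_covol_mul_orbitalIntegral`** — the same for a Borel `f : G(𝔸_F) → ℂ`
  with `∫⁻ Σ'_{γ ∈ 𝔬} ‖f(x̃ γ x̃⁻¹)‖ dμ < ∞` ((L4-e) ★ `lintegral_conjTsum_fiber_enorm_lt_top` for `f ∈ C_c`, `𝔬`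
  elliptic): integrability, absolute convergence, and the identity in the currency ★ `orbitalIntegral`.
* §5 **`integral_quotFun_kernelClass_diag_eq_mul_tsum_covol_mul_orbitalIntegral`** (automorphic `μ`, through §1)
  and **`truncatedTraceClass_eq_mul_tsum_covol_mul_orbitalIntegral_of_forall_ne`** — for a class `𝔬` missing
  `B(F)` ((L4-a) ★ `truncatedTraceClass_eq_integral_kernelClass_of_forall_ne`):
  `J^T_𝔬(f) = c_μ · Σ'_{s ⊆ 𝔬} vol(G_{γ_s} ⧸ G(F)_{γ_s}) · O_{γ_s}^{ν/ν_s}(f)` for every `T`.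

All instance binders (`G(𝔸_F)` Hausdorff ∕ locally compact ∕ second countable — `inferInstanceAs` over
★ `UnitaryGroupOfFormAdelicTopology`; `G(F)` closed — ★ `isClosed_quotientSubgroup_quasiSplit`; centralisers
closed — Mathlib `Set.isClosed_centralizer`; the counting measures Haar — §2) are theorems of the tree and
appear as binders only because the quotient measures in the statements are keyed on them.

## References
* J. D. Rogawski, *Automorphic Representations of Unitary Groups in Three Variables*, Ann. of Math. Stud.
  123 (1990), §2.2–2.3 pp. 13–14 [Rogawski1990].
* J. Arthur, *A trace formula for reductive groups I*, Duke Math. J. 45 (1978), §8 [Arthur1978TraceFormulaI].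
* S. Gelbart, *Automorphic forms on adele groups*, Ann. of Math. Stud. 83 (1975), (9.12)–(9.13), Thm. 9.22
  (ii), Remark 9.23 [Gelbart1975].
-/

set_option autoImplicit false

noncomputable section

open MeasureTheory Measure Set Filter Topology
open Literature.MeasureTheory.Group
open scoped NNReal ENNReal Pointwise

namespace Literature.NumberTheory.Automorphic

namespace UnitaryGroup

variable {F E : Type} [Field F] [NumberField F] [Field E] [NumberField E] [Algebra F E]
  {c : E ≃ₐ[F] E} {N : ℕ} {ι : Type*}

/-! ## §1 Dictionary: the descended diagonal class kernel is a sum over conjugates -/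

/-- **The fibre `{γ ∈ G(F) | cl γ = 𝔬}` of a conjugation-invariant class map, as a subset of `G(𝔸_F)`, is
stable under conjugation by `A_G · G(F) = G(F)`** (the `hS` slot of ★ `conjTsum`).
[cite: Rogawski1990, §2.2 (p. 13)] -/
theorem conj_mem_image_fiber {cl : (quasiSplit F E c N).arithmeticSubgroup → ι} (hcl : IsConjInvariant cl)
    (i : ι) :
    ∀ ℓ ∈ (quasiSplit F E c N).quotientSubgroup,
      ∀ s ∈ ((↑) : (quasiSplit F E c N).arithmeticSubgroup → (quasiSplit F E c N).Adelic) '' (cl ⁻¹' {i}),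
        ℓ * s * ℓ⁻¹ ∈
          ((↑) : (quasiSplit F E c N).arithmeticSubgroup → (quasiSplit F E c N).Adelic) '' (cl ⁻¹' {i}) := by
  intro ℓ hℓ s hs
  obtain ⟨γ, hγ, rfl⟩ := hs
  have hℓ' : ℓ ∈ (quasiSplit F E c N).arithmeticSubgroup := by
    rw [quotientSubgroup_quasiSplit] at hℓ; exact hℓ
  refine ⟨⟨ℓ, hℓ'⟩ * γ * ⟨ℓ, hℓ'⟩⁻¹, ?_, ?_⟩
  · rw [Set.mem_preimage, hcl γ ⟨ℓ, hℓ'⟩]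
    exact hγ
  · rw [Subgroup.coe_mul, Subgroup.coe_mul, Subgroup.coe_inv]

/-- The fibre, as a subset of `G(𝔸_F)`, lies in `G(F)`. [cite: Rogawski1990, §2.2 (p. 13)] -/
theorem image_fiber_subset_arithmeticSubgroup (cl : (quasiSplit F E c N).arithmeticSubgroup → ι) (i : ι) :
    ((↑) : (quasiSplit F E c N).arithmeticSubgroup → (quasiSplit F E c N).Adelic) '' (cl ⁻¹' {i}) ⊆
      ((quasiSplit F E c N).arithmeticSubgroup : Set (quasiSplit F E c N).Adelic) := by
  rintro _ ⟨γ, -, rfl⟩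
  exact γ.2

/-- `γ_s = rep s` lies in the class `𝔬 = cl⁻¹ {i}` iff its image lies in the fibre subset of `G(𝔸_F)`
(injectivity of `G(F) ↪ G(𝔸_F)`). [cite: Rogawski1990, §2.2 (p. 13)] -/
theorem apply_eq_iff_coe_mem_image_fiber (cl : (quasiSplit F E c N).arithmeticSubgroup → ι) (i : ι)
    (γ : (quasiSplit F E c N).arithmeticSubgroup) :
    cl γ = i ↔ (γ : (quasiSplit F E c N).Adelic) ∈
      ((↑) : (quasiSplit F E c N).arithmeticSubgroup → (quasiSplit F E c N).Adelic) '' (cl ⁻¹' {i}) :=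
  ⟨fun h => ⟨γ, h, rfl⟩, fun ⟨γ', hγ', hγe⟩ => by
    have h : γ' = γ := Subtype.ext hγe
    rw [← h]
    exact hγ'⟩

/-- **The descended diagonal class kernel at the class of `g` is `K_𝔬(g⁻¹, g⁻¹) = Σ'_{γ ∈ 𝔬} f(g γ g⁻¹)`**
(★ `quotFun_toAutomorphicQuotient` — the tree's dictionary `[g] ↦ g⁻¹` between the print's right cosets
`G(F)\G(𝔸)` and Mathlib's left cosets — and the diagonal `G(F)`-invariance ★ `kernelClass_diag_rational_mul`).
[cite: Rogawski1990, §2.2 (p. 13)] -/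
theorem quotFun_kernelClass_diag_toAutomorphicQuotient {cl : (quasiSplit F E c N).arithmeticSubgroup → ι}
    (hcl : IsConjInvariant cl) (i : ι) (f : (quasiSplit F E c N).Adelic → ℂ) (g : (quasiSplit F E c N).Adelic) :
    (quasiSplit F E c N).quotFun (fun x => kernelClass cl i f x x) ((quasiSplit F E c N).toAutomorphicQuotient g) =
      ∑' γ : cl ⁻¹' {i},
        f (g * ((γ : (quasiSplit F E c N).arithmeticSubgroup) : (quasiSplit F E c N).Adelic) * g⁻¹) := by
  have hinv : ∀ δ ∈ (quasiSplit F E c N).quotientSubgroup, ∀ x : (quasiSplit F E c N).Adelic,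
      (fun x => kernelClass cl i f x x) (δ * x) = (fun x => kernelClass cl i f x x) x := by
    intro δ hδ x
    have hδ' : δ ∈ (quasiSplit F E c N).arithmeticSubgroup := by
      rw [quotientSubgroup_quasiSplit] at hδ; exact hδ
    exact kernelClass_diag_rational_mul hcl i f ⟨δ, hδ'⟩ x x
  rw [AdelicGroupData.quotFun_toAutomorphicQuotient hinv g, kernelClass_def]
  simp only [inv_inv]

/-- **DICTIONARY `K_𝔬 ↔ conjTsum`: the descended diagonal class kernel `[g] ↦ K_𝔬(g⁻¹, g⁻¹)` IS the sum over
conjugates `conjTsum (A_G·G(F)) {γ | cl γ = 𝔬} f : [g] ↦ Σ'_{γ ∈ 𝔬} f(g γ g⁻¹)`** of the tree's generic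
geometric-side engine (★ `InvariantQuotientConjugacySum`), for every `f` and every conjugation-invariant class map
(Rogawski (1990), §2.2: `K_𝔬(x, x) = Σ_{γ ∈ 𝔬} f(x⁻¹ γ x)`; Gelbart (1975), (9.12)).
[cite: Rogawski1990, §2.2 (p. 13)] [cite: Gelbart1975, (9.12)] -/
theorem quotFun_kernelClass_diag_eq_conjTsum {cl : (quasiSplit F E c N).arithmeticSubgroup → ι}
    (hcl : IsConjInvariant cl) (i : ι) (f : (quasiSplit F E c N).Adelic → ℂ) :
    (quasiSplit F E c N).quotFun (fun x => kernelClass cl i f x x) =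
      conjTsum (quasiSplit F E c N).quotientSubgroup
        (((↑) : (quasiSplit F E c N).arithmeticSubgroup → (quasiSplit F E c N).Adelic) '' (cl ⁻¹' {i}))
        (conj_mem_image_fiber hcl i) f := by
  funext x
  induction x using QuotientGroup.induction_on with
  | H g =>
    change (quasiSplit F E c N).quotFun (fun x => kernelClass cl i f x x)
        ((quasiSplit F E c N).toAutomorphicQuotient g) = _
    rw [quotFun_kernelClass_diag_toAutomorphicQuotient hcl i f g, conjTsum_mk]
    exact (Equiv.Set.image
      ((↑) : (quasiSplit F E c N).arithmeticSubgroup → (quasiSplit F E c N).Adelic) (cl ⁻¹' {i})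
      Subtype.val_injective).tsum_eq
      (fun s : ↥(((↑) : (quasiSplit F E c N).arithmeticSubgroup → (quasiSplit F E c N).Adelic) ''
        (cl ⁻¹' {i})) => f (g * (s : (quasiSplit F E c N).Adelic) * g⁻¹))

/-! ## §2 Structure of the quasi-split datum: discreteness and counting Haar measures -/

/-- `A_G · G(F) = G(F)` is discrete in `G(𝔸_F)` (★ `isDiscreteRational_quasiSplit`, ★ `quotientSubgroup_quasiSplit`).
[cite: Borel1963, §5] -/
theorem discreteTopology_quotientSubgroup_quasiSplit :
    DiscreteTopology (quasiSplit F E c N).quotientSubgroup := by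
  rw [quotientSubgroup_quasiSplit]; exact isDiscreteRational_quasiSplit

/-- `G(F)` (the arithmetic subgroup) is countable. [cite: Borel1963, §5] -/
theorem countable_arithmeticSubgroup_quasiSplit : Countable (quasiSplit F E c N).arithmeticSubgroup := by
  rw [← quotientSubgroup_quasiSplit]; exact countable_quotientSubgroup_quasiSplit

/-- `G(𝔸_F)` is Hausdorff (★ `UnitaryGroupOfFormAdelicTopology`, transported to the datum's carrier).
[folklore] -/
private theorem t2Space_quasiSplit_adelic₀ : T2Space (quasiSplit F E c N).Adelic :=
  inferInstanceAs (T2Space (adelic F E c N ((StdForm.antidiagonal N).over E)))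

/-- `A_G·G(F) ∩ C` is discrete, for every subgroup `C ≤ G(𝔸_F)`. [folklore] -/
private theorem discreteTopology_inf_quasiSplit (C : Subgroup (quasiSplit F E c N).Adelic) :
    DiscreteTopology ↥((quasiSplit F E c N).quotientSubgroup ⊓ C) := by
  haveI := discreteTopology_quotientSubgroup_quasiSplit (F := F) (E := E) (c := c) (N := N)
  exact DiscreteTopology.of_continuous_injective
    (f := fun x : ↥((quasiSplit F E c N).quotientSubgroup ⊓ C) =>
      (⟨(x : (quasiSplit F E c N).Adelic), (Subgroup.mem_inf.1 x.2).1⟩ : (quasiSplit F E c N).quotientSubgroup))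
    (continuous_subtype_val.subtype_mk _)
    fun _ _ hab => Subtype.ext (congrArg (fun y : (quasiSplit F E c N).quotientSubgroup =>
      (y : (quasiSplit F E c N).Adelic)) hab)

/-- `A_G·G(F) ∩ C` is countable. [folklore] -/
private theorem countable_inf_quasiSplit (C : Subgroup (quasiSplit F E c N).Adelic) :
    Countable ↥((quasiSplit F E c N).quotientSubgroup ⊓ C) := by
  haveI := countable_quotientSubgroup_quasiSplit (F := F) (E := E) (c := c) (N := N)
  exact Function.Injective.countable (f := fun x : ↥((quasiSplit F E c N).quotientSubgroup ⊓ C) =>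
      (⟨(x : (quasiSplit F E c N).Adelic), (Subgroup.mem_inf.1 x.2).1⟩ : (quasiSplit F E c N).quotientSubgroup))
    fun _ _ hab => Subtype.ext (congrArg (fun y : (quasiSplit F E c N).quotientSubgroup =>
      (y : (quasiSplit F E c N).Adelic)) hab)

/-- `(A_G·G(F) ∩ C).subgroupOf C` is countable. [folklore] -/
private theorem countable_inf_subgroupOf_quasiSplit (C : Subgroup (quasiSplit F E c N).Adelic) :
    Countable ↥(((quasiSplit F E c N).quotientSubgroup ⊓ C).subgroupOf C) := by
  haveI := countable_quotientSubgroup_quasiSplit (F := F) (E := E) (c := c) (N := N)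
  exact Function.Injective.countable
    (f := fun x : ↥(((quasiSplit F E c N).quotientSubgroup ⊓ C).subgroupOf C) =>
      (⟨((x : C) : (quasiSplit F E c N).Adelic), (Subgroup.mem_inf.1 (Subgroup.mem_subgroupOf.1 x.2)).1⟩ :
        (quasiSplit F E c N).quotientSubgroup))
    fun _ _ hab => Subtype.ext (Subtype.ext (congrArg (fun y : (quasiSplit F E c N).quotientSubgroup =>
      (y : (quasiSplit F E c N).Adelic)) hab))

section Measure

variable [MeasurableSpace (quasiSplit F E c N).Adelic] [BorelSpace (quasiSplit F E c N).Adelic]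

/-- **Counting measure is a Haar measure on the discrete `A_G·G(F) = G(F)`.** [cite: Gelbart1975, Remark 9.23] -/
theorem isHaarMeasure_count_quotientSubgroup_quasiSplit :
    (count : Measure (quasiSplit F E c N).quotientSubgroup).IsHaarMeasure := by
  haveI := t2Space_quasiSplit_adelic₀ (F := F) (E := E) (c := c) (N := N)
  haveI := discreteTopology_quotientSubgroup_quasiSplit (F := F) (E := E) (c := c) (N := N)
  haveI := countable_quotientSubgroup_quasiSplit (F := F) (E := E) (c := c) (N := N)
  exact isHaarMeasure_count_of_discrete

/-- Counting measure is a Haar measure on the discrete `A_G·G(F) ∩ C ≤ G(𝔸_F)`. [cite: Gelbart1975, Remark 9.23] -/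
private theorem isHaarMeasure_count_inf_quasiSplit (C : Subgroup (quasiSplit F E c N).Adelic) :
    (count : Measure ↥((quasiSplit F E c N).quotientSubgroup ⊓ C)).IsHaarMeasure := by
  haveI := t2Space_quasiSplit_adelic₀ (F := F) (E := E) (c := c) (N := N)
  haveI := discreteTopology_inf_quasiSplit (F := F) (E := E) (c := c) (N := N) C
  haveI := countable_inf_quasiSplit (F := F) (E := E) (c := c) (N := N) C
  exact isHaarMeasure_count_of_discrete

/-- **Counting measure is a Haar measure on `G(F)_γ = G(F) ∩ G_γ` viewed inside the adelic centraliser `G_γ`**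
(★ `AdelicGroupData.isHaarMeasure_count_inf_subgroupOf`; the measure on the discrete `G(F)_γ` implicit in the printed
covolume) — discharger of the corresponding binder of §3–§5. [cite: Gelbart1975, Remark 9.23] -/
theorem isHaarMeasure_count_inf_centralizer_subgroupOf_quasiSplit (γ : (quasiSplit F E c N).Adelic) :
    (count : Measure ↥(((quasiSplit F E c N).quotientSubgroup ⊓
      Subgroup.centralizer ({γ} : Set (quasiSplit F E c N).Adelic)).subgroupOf
        (Subgroup.centralizer ({γ} : Set (quasiSplit F E c N).Adelic)))).IsHaarMeasure := by
  haveI := t2Space_quasiSplit_adelic₀ (F := F) (E := E) (c := c) (N := N)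
  haveI := discreteTopology_quotientSubgroup_quasiSplit (F := F) (E := E) (c := c) (N := N)
  haveI := countable_quotientSubgroup_quasiSplit (F := F) (E := E) (c := c) (N := N)
  exact (quasiSplit F E c N).isHaarMeasure_count_inf_subgroupOf _

omit [BorelSpace (quasiSplit F E c N).Adelic] in
/-- Counting measures restrict to counting measures (pull-back along an injection of countable types with measurable
singletons). [folklore] -/
private theorem comap_count_eq_count₀ {α β : Type*} [MeasurableSpace α] [MeasurableSpace β] [Countable α]
    [Countable β] [MeasurableSingletonClass α] [MeasurableSingletonClass β] {f : α → β}
    (hf : Function.Injective f) : (count : Measure β).comap f = count := by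
  refine Measure.ext_of_singleton fun a => ?_
  rw [Measure.comap_apply f hf (fun s _ => (Set.to_countable _).measurableSet) _ (measurableSet_singleton a),
    Set.image_singleton, count_singleton, count_singleton]

omit [BorelSpace (quasiSplit F E c N).Adelic] in
/-- … and push forward to counting measures along measurable bijections. [folklore] -/
private theorem map_count_eq_count₀ {α β : Type*} [MeasurableSpace α] [MeasurableSpace β] [Countable α]
    [Countable β] [MeasurableSingletonClass α] [MeasurableSingletonClass β] (e : α ≃ β) (he : Measurable e) :
    (count : Measure α).map e = count := by
  refine Measure.ext_of_singleton fun b => ?_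
  rw [Measure.map_apply he (measurableSet_singleton b), count_singleton]
  have h : (e : α → β) ⁻¹' {b} = {e.symm b} := by
    ext a
    simp only [Set.mem_preimage, Set.mem_singleton_iff, Equiv.apply_eq_iff_eq_symm_apply]
  rw [h, count_singleton]

/-! ## §3 The `[0, ∞]`-valued unfolding of one class, with covolume weights -/

/-- **THE `𝔬`-TERM UNFOLDS INTO ORBITAL INTEGRALS WITH COVOLUME WEIGHTS, `[0, ∞]`-valued** (Arthur (1978), §8;
Rogawski (1990), §2.3: the elliptic `J_𝔬(f)`; Gelbart (1975), (9.13) ∕ Thm. 9.22 (ii) with the printed volumes).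
Setting: `G = U(J_N)(𝔸_F)` with `A_G · G(F) = G(F)` discrete and closed; an invariant Borel measure `μ ≠ 0` on
`X = G(𝔸_F) ⧸ G(F)` finite on compact sets; a Haar measure `ν` on `G(𝔸_F)` (two-sided); a conjugation-invariant
class map `cl` on `G(F)` and a class `𝔬 = cl⁻¹ {i}`; a section `rep` of the conjugacy classes of `G(F)`; for
each class `s ⊆ 𝔬` a Haar measure `ν_s` on the adelic centraliser `G_{γ_s} = C(γ_s)`, `γ_s = rep s` (two-sided,
inversion invariant) with `G_{γ_s} ⧸ G(F)_{γ_s}` COMPACT (the elliptic input, ★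
`compactSpace_centralizer_quotient_of_forall_cl_ne`). Then for every Borel `Φ : G(𝔸_F) → [0, ∞]`

  `∫_X Σ'_{γ ∈ 𝔬} Φ(x̃ γ x̃⁻¹) dμ(x) = c_μ · Σ'_{s ⊆ 𝔬} vol(G_{γ_s} ⧸ G(F)_{γ_s}) · ∫_{G(𝔸_F) ⧸ G_{γ_s}} Φ(y γ_s y⁻¹) d(ν/ν_s)(y)`,

`c_μ = unfoldingConstant G(F) count μ ν` (Weil's constant of `μ`, `= 1` for `μ = ν/count`), `ν/ν_s = quotientMeasure
G_{γ_s} ν_s ν` (Weil constant one), `vol(G_{γ_s} ⧸ G(F)_{γ_s})` the total mass of `quotientMeasure (G(F)_{γ_s} ≤ G_{γ_s})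
count ν_s` — ★ `lintegral_conjTsum_subset_eq_mul_tsum_covol_mul` for `Γ = L = G(F)`, `S = 𝔬`, the counting measures
on `G(F)`, `G(F)_{γ_s}`, re-indexed by `{s // cl (rep s) = i}`. [cite: Arthur1978TraceFormulaI, §8]
[cite: Rogawski1990, §2.2 (p. 13)] [cite: Gelbart1975, (9.13) and Thm. 9.22 (ii)] -/
theorem lintegral_conjTsum_fiber_eq_mul_tsum_covol_mul
    [T2Space (quasiSplit F E c N).Adelic] [LocallyCompactSpace (quasiSplit F E c N).Adelic]
    [SecondCountableTopology (quasiSplit F E c N).Adelic]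
    [∀ γ : (quasiSplit F E c N).Adelic, MeasurableSpace ((quasiSplit F E c N).Adelic ⧸
      Subgroup.centralizer ({γ} : Set (quasiSplit F E c N).Adelic))]
    [∀ γ : (quasiSplit F E c N).Adelic, BorelSpace ((quasiSplit F E c N).Adelic ⧸
      Subgroup.centralizer ({γ} : Set (quasiSplit F E c N).Adelic))]
    [∀ γ : (quasiSplit F E c N).Adelic, MeasurableSpace (↥(Subgroup.centralizer ({γ} : Set (quasiSplit F E c N).Adelic)) ⧸
      ((quasiSplit F E c N).quotientSubgroup ⊓ Subgroup.centralizer ({γ} : Set (quasiSplit F E c N).Adelic)).subgroupOf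
        (Subgroup.centralizer ({γ} : Set (quasiSplit F E c N).Adelic)))]
    [∀ γ : (quasiSplit F E c N).Adelic, BorelSpace (↥(Subgroup.centralizer ({γ} : Set (quasiSplit F E c N).Adelic)) ⧸
      ((quasiSplit F E c N).quotientSubgroup ⊓ Subgroup.centralizer ({γ} : Set (quasiSplit F E c N).Adelic)).subgroupOf
        (Subgroup.centralizer ({γ} : Set (quasiSplit F E c N).Adelic)))]
    [hL : IsClosed (((quasiSplit F E c N).quotientSubgroup : Set (quasiSplit F E c N).Adelic))]
    [hCcl : ∀ γ : (quasiSplit F E c N).Adelic, IsClosed ((Subgroup.centralizer ({γ} : Set (quasiSplit F E c N).Adelic) :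
      Subgroup (quasiSplit F E c N).Adelic) : Set (quasiSplit F E c N).Adelic)]
    [∀ γ : (quasiSplit F E c N).Adelic, (count : Measure ↥(((quasiSplit F E c N).quotientSubgroup ⊓
      Subgroup.centralizer ({γ} : Set (quasiSplit F E c N).Adelic)).subgroupOf
        (Subgroup.centralizer ({γ} : Set (quasiSplit F E c N).Adelic)))).IsHaarMeasure]
    [(count : Measure (quasiSplit F E c N).quotientSubgroup).IsHaarMeasure]
    [MeasurableSpace ((quasiSplit F E c N).Adelic ⧸ (quasiSplit F E c N).quotientSubgroup)]
    [BorelSpace ((quasiSplit F E c N).Adelic ⧸ (quasiSplit F E c N).quotientSubgroup)]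
    (μ : Measure ((quasiSplit F E c N).Adelic ⧸ (quasiSplit F E c N).quotientSubgroup))
    [SMulInvariantMeasure (quasiSplit F E c N).Adelic ((quasiSplit F E c N).Adelic ⧸ (quasiSplit F E c N).quotientSubgroup) μ]
    [IsFiniteMeasureOnCompacts μ] (hμ : μ ≠ 0)
    (ν : Measure (quasiSplit F E c N).Adelic) [IsHaarMeasure ν] [ν.IsMulRightInvariant]
    {cl : (quasiSplit F E c N).arithmeticSubgroup → ι} (hcl : IsConjInvariant cl) (i : ι)
    (rep : ConjClasses (quasiSplit F E c N).arithmeticSubgroup → (quasiSplit F E c N).arithmeticSubgroup)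
    (hrep : ∀ s, ConjClasses.mk (rep s) = s)
    (νC : ∀ s : {s : ConjClasses (quasiSplit F E c N).arithmeticSubgroup // cl (rep s) = i},
      Measure ↥(Subgroup.centralizer ({((rep s.1 : (quasiSplit F E c N).arithmeticSubgroup) : (quasiSplit F E c N).Adelic)} :
        Set (quasiSplit F E c N).Adelic)))
    [∀ s, IsHaarMeasure (νC s)] [∀ s, (νC s).IsMulRightInvariant] [∀ s, (νC s).IsInvInvariant]
    [hcpt : ∀ s : {s : ConjClasses (quasiSplit F E c N).arithmeticSubgroup // cl (rep s) = i},
      CompactSpace (↥(Subgroup.centralizer ({((rep s.1 : (quasiSplit F E c N).arithmeticSubgroup) :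
        (quasiSplit F E c N).Adelic)} : Set (quasiSplit F E c N).Adelic)) ⧸
        ((quasiSplit F E c N).quotientSubgroup ⊓ Subgroup.centralizer ({((rep s.1 : (quasiSplit F E c N).arithmeticSubgroup) :
          (quasiSplit F E c N).Adelic)} : Set (quasiSplit F E c N).Adelic)).subgroupOf
          (Subgroup.centralizer ({((rep s.1 : (quasiSplit F E c N).arithmeticSubgroup) : (quasiSplit F E c N).Adelic)} :
            Set (quasiSplit F E c N).Adelic)))]
    {Φ : (quasiSplit F E c N).Adelic → ℝ≥0∞} (hΦ : Measurable Φ) :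
    ∫⁻ x, conjTsum (quasiSplit F E c N).quotientSubgroup
        (((↑) : (quasiSplit F E c N).arithmeticSubgroup → (quasiSplit F E c N).Adelic) '' (cl ⁻¹' {i}))
        (conj_mem_image_fiber hcl i) Φ x ∂μ =
      unfoldingConstant (quasiSplit F E c N).quotientSubgroup (count : Measure (quasiSplit F E c N).quotientSubgroup) μ ν *
        ∑' s : {s : ConjClasses (quasiSplit F E c N).arithmeticSubgroup // cl (rep s) = i},
          quotientMeasure (((quasiSplit F E c N).quotientSubgroup ⊓ Subgroup.centralizer
              ({((rep s.1 : (quasiSplit F E c N).arithmeticSubgroup) : (quasiSplit F E c N).Adelic)} :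
                Set (quasiSplit F E c N).Adelic)).subgroupOf
              (Subgroup.centralizer ({((rep s.1 : (quasiSplit F E c N).arithmeticSubgroup) : (quasiSplit F E c N).Adelic)} :
                Set (quasiSplit F E c N).Adelic))) count (isClosed_subgroupOf _ _ (hL.inter (hCcl _))) (νC s) Set.univ *
            ∫⁻ y, descConj ((rep s.1 : (quasiSplit F E c N).arithmeticSubgroup) : (quasiSplit F E c N).Adelic)
              (Subgroup.centralizer ({((rep s.1 : (quasiSplit F E c N).arithmeticSubgroup) : (quasiSplit F E c N).Adelic)} :
                Set (quasiSplit F E c N).Adelic))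
              (fun _ hg => Subgroup.mem_centralizer_singleton_iff.1 hg) Φ y
              ∂quotientMeasure (Subgroup.centralizer ({((rep s.1 : (quasiSplit F E c N).arithmeticSubgroup) :
                (quasiSplit F E c N).Adelic)} : Set (quasiSplit F E c N).Adelic)) (νC s) (hCcl _) ν := by
  classical
  haveI : DiscreteTopology (quasiSplit F E c N).quotientSubgroup := discreteTopology_quotientSubgroup_quasiSplit
  haveI : Countable (quasiSplit F E c N).quotientSubgroup := countable_quotientSubgroup_quasiSplit
  haveI : Countable (quasiSplit F E c N).arithmeticSubgroup := countable_arithmeticSubgroup_quasiSplit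
  -- the index types and their identification
  have hiff : ∀ s : ConjClasses (quasiSplit F E c N).arithmeticSubgroup, cl (rep s) = i ↔
      ((rep s : (quasiSplit F E c N).arithmeticSubgroup) : (quasiSplit F E c N).Adelic) ∈
        ((↑) : (quasiSplit F E c N).arithmeticSubgroup → (quasiSplit F E c N).Adelic) '' (cl ⁻¹' {i}) :=
    fun s => apply_eq_iff_coe_mem_image_fiber cl i (rep s)
  -- per-class instances, indexed by the subset-first index type of ★
  haveI : ∀ s : {s : ConjClasses (quasiSplit F E c N).arithmeticSubgroup //
      ((rep s : (quasiSplit F E c N).arithmeticSubgroup) : (quasiSplit F E c N).Adelic) ∈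
        ((↑) : (quasiSplit F E c N).arithmeticSubgroup → (quasiSplit F E c N).Adelic) '' (cl ⁻¹' {i})},
      IsClosed ((((quasiSplit F E c N).quotientSubgroup ⊓ Subgroup.centralizer
        ({((rep s.1 : (quasiSplit F E c N).arithmeticSubgroup) : (quasiSplit F E c N).Adelic)} :
          Set (quasiSplit F E c N).Adelic)) : Subgroup (quasiSplit F E c N).Adelic) : Set (quasiSplit F E c N).Adelic) :=
    fun s => hL.inter (hCcl _)
  haveI : ∀ s : {s : ConjClasses (quasiSplit F E c N).arithmeticSubgroup //
      ((rep s : (quasiSplit F E c N).arithmeticSubgroup) : (quasiSplit F E c N).Adelic) ∈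
        ((↑) : (quasiSplit F E c N).arithmeticSubgroup → (quasiSplit F E c N).Adelic) '' (cl ⁻¹' {i})},
      IsClosed ((Subgroup.centralizer ({((rep s.1 : (quasiSplit F E c N).arithmeticSubgroup) : (quasiSplit F E c N).Adelic)} :
        Set (quasiSplit F E c N).Adelic) : Subgroup (quasiSplit F E c N).Adelic) : Set (quasiSplit F E c N).Adelic) :=
    fun s => hCcl _
  haveI : ∀ s : {s : ConjClasses (quasiSplit F E c N).arithmeticSubgroup //
      ((rep s : (quasiSplit F E c N).arithmeticSubgroup) : (quasiSplit F E c N).Adelic) ∈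
        ((↑) : (quasiSplit F E c N).arithmeticSubgroup → (quasiSplit F E c N).Adelic) '' (cl ⁻¹' {i})},
      (count : Measure ↥((quasiSplit F E c N).quotientSubgroup ⊓ Subgroup.centralizer
        ({((rep s.1 : (quasiSplit F E c N).arithmeticSubgroup) : (quasiSplit F E c N).Adelic)} :
          Set (quasiSplit F E c N).Adelic))).IsHaarMeasure :=
    fun s => isHaarMeasure_count_inf_quasiSplit _
  haveI : ∀ s : {s : ConjClasses (quasiSplit F E c N).arithmeticSubgroup //
      ((rep s : (quasiSplit F E c N).arithmeticSubgroup) : (quasiSplit F E c N).Adelic) ∈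
        ((↑) : (quasiSplit F E c N).arithmeticSubgroup → (quasiSplit F E c N).Adelic) '' (cl ⁻¹' {i})},
      Countable ↥((quasiSplit F E c N).quotientSubgroup ⊓ Subgroup.centralizer
        ({((rep s.1 : (quasiSplit F E c N).arithmeticSubgroup) : (quasiSplit F E c N).Adelic)} :
          Set (quasiSplit F E c N).Adelic)) :=
    fun s => countable_inf_quasiSplit _
  haveI : ∀ s : {s : ConjClasses (quasiSplit F E c N).arithmeticSubgroup //
      ((rep s : (quasiSplit F E c N).arithmeticSubgroup) : (quasiSplit F E c N).Adelic) ∈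
        ((↑) : (quasiSplit F E c N).arithmeticSubgroup → (quasiSplit F E c N).Adelic) '' (cl ⁻¹' {i})},
      Countable ↥(((quasiSplit F E c N).quotientSubgroup ⊓ Subgroup.centralizer
        ({((rep s.1 : (quasiSplit F E c N).arithmeticSubgroup) : (quasiSplit F E c N).Adelic)} :
          Set (quasiSplit F E c N).Adelic)).subgroupOf (Subgroup.centralizer
        ({((rep s.1 : (quasiSplit F E c N).arithmeticSubgroup) : (quasiSplit F E c N).Adelic)} :
          Set (quasiSplit F E c N).Adelic))) :=
    fun s => countable_inf_subgroupOf_quasiSplit _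
  haveI : ∀ s : {s : ConjClasses (quasiSplit F E c N).arithmeticSubgroup //
      ((rep s : (quasiSplit F E c N).arithmeticSubgroup) : (quasiSplit F E c N).Adelic) ∈
        ((↑) : (quasiSplit F E c N).arithmeticSubgroup → (quasiSplit F E c N).Adelic) '' (cl ⁻¹' {i})},
      CompactSpace (↥(Subgroup.centralizer ({((rep s.1 : (quasiSplit F E c N).arithmeticSubgroup) :
        (quasiSplit F E c N).Adelic)} : Set (quasiSplit F E c N).Adelic)) ⧸
        ((quasiSplit F E c N).quotientSubgroup ⊓ Subgroup.centralizer ({((rep s.1 : (quasiSplit F E c N).arithmeticSubgroup) :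
          (quasiSplit F E c N).Adelic)} : Set (quasiSplit F E c N).Adelic)).subgroupOf
          (Subgroup.centralizer ({((rep s.1 : (quasiSplit F E c N).arithmeticSubgroup) : (quasiSplit F E c N).Adelic)} :
            Set (quasiSplit F E c N).Adelic))) :=
    fun s => hcpt ⟨s.1, (hiff s.1).2 s.2⟩
  haveI : ∀ s : {s : ConjClasses (quasiSplit F E c N).arithmeticSubgroup //
      ((rep s : (quasiSplit F E c N).arithmeticSubgroup) : (quasiSplit F E c N).Adelic) ∈
        ((↑) : (quasiSplit F E c N).arithmeticSubgroup → (quasiSplit F E c N).Adelic) '' (cl ⁻¹' {i})},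
      (νC ⟨s.1, (hiff s.1).2 s.2⟩).IsHaarMeasure := fun s => inferInstance
  haveI : ∀ s : {s : ConjClasses (quasiSplit F E c N).arithmeticSubgroup //
      ((rep s : (quasiSplit F E c N).arithmeticSubgroup) : (quasiSplit F E c N).Adelic) ∈
        ((↑) : (quasiSplit F E c N).arithmeticSubgroup → (quasiSplit F E c N).Adelic) '' (cl ⁻¹' {i})},
      (νC ⟨s.1, (hiff s.1).2 s.2⟩).IsMulRightInvariant := fun s => inferInstance
  haveI : ∀ s : {s : ConjClasses (quasiSplit F E c N).arithmeticSubgroup //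
      ((rep s : (quasiSplit F E c N).arithmeticSubgroup) : (quasiSplit F E c N).Adelic) ∈
        ((↑) : (quasiSplit F E c N).arithmeticSubgroup → (quasiSplit F E c N).Adelic) '' (cl ⁻¹' {i})},
      (νC ⟨s.1, (hiff s.1).2 s.2⟩).IsInvInvariant := fun s => inferInstance
  haveI : ∀ s : {s : ConjClasses (quasiSplit F E c N).arithmeticSubgroup //
      ((rep s : (quasiSplit F E c N).arithmeticSubgroup) : (quasiSplit F E c N).Adelic) ∈
        ((↑) : (quasiSplit F E c N).arithmeticSubgroup → (quasiSplit F E c N).Adelic) '' (cl ⁻¹' {i})},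
      SFinite (νC ⟨s.1, (hiff s.1).2 s.2⟩) := fun s => inferInstance
  -- the restricted counting measures are counting measures
  have hρH : ∀ s : {s : ConjClasses (quasiSplit F E c N).arithmeticSubgroup //
      ((rep s : (quasiSplit F E c N).arithmeticSubgroup) : (quasiSplit F E c N).Adelic) ∈
        ((↑) : (quasiSplit F E c N).arithmeticSubgroup → (quasiSplit F E c N).Adelic) '' (cl ⁻¹' {i})},
      (count : Measure ↥((quasiSplit F E c N).quotientSubgroup ⊓ Subgroup.centralizer
        ({((rep s.1 : (quasiSplit F E c N).arithmeticSubgroup) : (quasiSplit F E c N).Adelic)} :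
          Set (quasiSplit F E c N).Adelic))) =
        (count : Measure (quasiSplit F E c N).quotientSubgroup).comap
          (Subgroup.inclusion (le_of_mem_iff (quasiSplit F E c N).quotientSubgroup _
            (fun g => mem_inf_centralizer_singleton_iff _ _ g))) :=
    fun s => (comap_count_eq_count₀ (Subgroup.inclusion_injective _)).symm
  have hρF : ∀ s : {s : ConjClasses (quasiSplit F E c N).arithmeticSubgroup //
      ((rep s : (quasiSplit F E c N).arithmeticSubgroup) : (quasiSplit F E c N).Adelic) ∈
        ((↑) : (quasiSplit F E c N).arithmeticSubgroup → (quasiSplit F E c N).Adelic) '' (cl ⁻¹' {i})},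
      (count : Measure ↥(((quasiSplit F E c N).quotientSubgroup ⊓ Subgroup.centralizer
        ({((rep s.1 : (quasiSplit F E c N).arithmeticSubgroup) : (quasiSplit F E c N).Adelic)} :
          Set (quasiSplit F E c N).Adelic)).subgroupOf (Subgroup.centralizer
        ({((rep s.1 : (quasiSplit F E c N).arithmeticSubgroup) : (quasiSplit F E c N).Adelic)} :
          Set (quasiSplit F E c N).Adelic)))) =
        Measure.map (Subgroup.subgroupOfEquivOfLe (inf_le_right :
          (quasiSplit F E c N).quotientSubgroup ⊓ Subgroup.centralizer
            ({((rep s.1 : (quasiSplit F E c N).arithmeticSubgroup) : (quasiSplit F E c N).Adelic)} :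
              Set (quasiSplit F E c N).Adelic) ≤ _)).symm
          (count : Measure ↥((quasiSplit F E c N).quotientSubgroup ⊓ Subgroup.centralizer
            ({((rep s.1 : (quasiSplit F E c N).arithmeticSubgroup) : (quasiSplit F E c N).Adelic)} :
              Set (quasiSplit F E c N).Adelic))) :=
    fun s => (map_count_eq_count₀ (Subgroup.subgroupOfEquivOfLe inf_le_right).symm.toEquiv
      (continuous_subgroupOfEquivOfLe_symm _ _ inf_le_right).measurable).symm
  -- relative openness of `G(F)_γ` in the discrete `G(F)` (trivial central retraction)
  have hc0 : (quasiSplit F E c N).center' = ⊥ := rfl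
  have hθA : ∀ g : (quasiSplit F E c N).Adelic,
      (1 : (quasiSplit F E c N).Adelic →* (quasiSplit F E c N).Adelic) g ∈ (quasiSplit F E c N).center' := fun g => by
    rw [MonoidHom.one_apply]; exact one_mem _
  have hθa : ∀ a ∈ (quasiSplit F E c N).center',
      (1 : (quasiSplit F E c N).Adelic →* (quasiSplit F E c N).Adelic) a = a := fun a ha => by
    rw [hc0, Subgroup.mem_bot] at ha
    rw [ha, MonoidHom.one_apply]
  have hopen := fun s : {s : ConjClasses (quasiSplit F E c N).arithmeticSubgroup //
      ((rep s : (quasiSplit F E c N).arithmeticSubgroup) : (quasiSplit F E c N).Adelic) ∈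
        ((↑) : (quasiSplit F E c N).arithmeticSubgroup → (quasiSplit F E c N).Adelic) '' (cl ⁻¹' {i})} =>
    AdelicGroupData.isOpen_subgroupOf_quotientSubgroup_of_center'_le (quasiSplit F E c N)
      isDiscreteRational_quasiSplit 1 continuous_const hθA hθa (fun _ _ => rfl)
      (AdelicGroupData.center'_le_inf_centralizer (quasiSplit F E c N)
        ((rep s.1 : (quasiSplit F E c N).arithmeticSubgroup) : (quasiSplit F E c N).Adelic))
  -- ★ subset unfolding with the printed constants, then re-index
  have key := Literature.MeasureTheory.Group.lintegral_conjTsum_subset_eq_mul_tsum_covol_mul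
    (quasiSplit F E c N).arithmeticSubgroup (quasiSplit F E c N).quotientSubgroup
    (quasiSplit F E c N).arithmeticSubgroup_le_quotientSubgroup
    (AdelicGroupData.exists_inv_mul_mem_centralizer_quotientSubgroup (quasiSplit F E c N)) rep hrep
    (image_fiber_subset_arithmeticSubgroup cl i) (conj_mem_image_fiber hcl i)
    (fun s => (quasiSplit F E c N).quotientSubgroup ⊓ Subgroup.centralizer
      ({((rep s.1 : (quasiSplit F E c N).arithmeticSubgroup) : (quasiSplit F E c N).Adelic)} :
        Set (quasiSplit F E c N).Adelic))
    (fun s => Subgroup.centralizer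
      ({((rep s.1 : (quasiSplit F E c N).arithmeticSubgroup) : (quasiSplit F E c N).Adelic)} :
        Set (quasiSplit F E c N).Adelic))
    (fun s g => mem_inf_centralizer_singleton_iff _ _ _) (fun s => inf_le_right)
    (fun s => fun _ hg => Subgroup.mem_centralizer_singleton_iff.1 hg) μ ν
    (count : Measure (quasiSplit F E c N).quotientSubgroup)
    (fun s => (count : Measure ↥((quasiSplit F E c N).quotientSubgroup ⊓ Subgroup.centralizer
      ({((rep s.1 : (quasiSplit F E c N).arithmeticSubgroup) : (quasiSplit F E c N).Adelic)} :
        Set (quasiSplit F E c N).Adelic))))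
    (fun s => (count : Measure ↥(((quasiSplit F E c N).quotientSubgroup ⊓ Subgroup.centralizer
      ({((rep s.1 : (quasiSplit F E c N).arithmeticSubgroup) : (quasiSplit F E c N).Adelic)} :
        Set (quasiSplit F E c N).Adelic)).subgroupOf (Subgroup.centralizer
      ({((rep s.1 : (quasiSplit F E c N).arithmeticSubgroup) : (quasiSplit F E c N).Adelic)} :
        Set (quasiSplit F E c N).Adelic)))))
    (fun s => νC ⟨s.1, (hiff s.1).2 s.2⟩) hopen hμ hρH hρF hΦ
  rw [key, ← (Equiv.subtypeEquivRight hiff).symm.tsum_eq]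
  rfl

/-! ## §4 Complex test functions: the `𝔬`-term in the currency `orbitalIntegral` -/

/-- **THE `𝔬`-TERM UNFOLDS INTO ORBITAL INTEGRALS WITH COVOLUME WEIGHTS, for complex test functions** (Arthur
(1978), §8; Rogawski (1990), §2.3; Gelbart (1975), (9.13) ∕ Thm. 9.22 (ii)). In the setting of
`lintegral_conjTsum_fiber_eq_mul_tsum_covol_mul`, for every Borel `f : G(𝔸_F) → ℂ` whose class sum of `‖f‖` has
finite integral over `X` (★ `lintegral_conjTsum_fiber_enorm_lt_top` for `f ∈ C_c` and `𝔬` off `B(F)`): the class sum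
`[x] ↦ Σ'_{γ ∈ 𝔬} f(x̃ γ x̃⁻¹)` is `μ`-integrable, every orbital integrand `y ↦ f(y γ_s y⁻¹)` is `ν/ν_s`-integrable, the
class series converges absolutely, and

  `∫_X Σ'_{γ ∈ 𝔬} f(x̃ γ x̃⁻¹) dμ(x) = c_μ · Σ'_{s ⊆ 𝔬} vol(G_{γ_s} ⧸ G(F)_{γ_s}) · O_{γ_s}^{ν/ν_s}(f)`,

`O_γ^m(f) = orbitalIntegral γ f m = ∫_{G(𝔸) ⧸ G_γ} f(y γ y⁻¹) dm(y)` (★ `LocalOrbitalIntegral`) — §3 passed to `ℂ` by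
★ `integral_conjTsum_eq_tsum_of_lintegral_complex` with `d_s = c_μ · vol_s ≠ 0`. [cite: Arthur1978TraceFormulaI, §8]
[cite: Rogawski1990, §2.2 (p. 13)] [cite: Gelbart1975, (9.13) and Thm. 9.22 (ii)] -/
theorem integral_conjTsum_fiber_eq_mul_tsum_covol_mul_orbitalIntegral
    [T2Space (quasiSplit F E c N).Adelic] [LocallyCompactSpace (quasiSplit F E c N).Adelic]
    [SecondCountableTopology (quasiSplit F E c N).Adelic]
    [∀ γ : (quasiSplit F E c N).Adelic, MeasurableSpace ((quasiSplit F E c N).Adelic ⧸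
      Subgroup.centralizer ({γ} : Set (quasiSplit F E c N).Adelic))]
    [∀ γ : (quasiSplit F E c N).Adelic, BorelSpace ((quasiSplit F E c N).Adelic ⧸
      Subgroup.centralizer ({γ} : Set (quasiSplit F E c N).Adelic))]
    [∀ γ : (quasiSplit F E c N).Adelic, MeasurableSpace (↥(Subgroup.centralizer ({γ} : Set (quasiSplit F E c N).Adelic)) ⧸
      ((quasiSplit F E c N).quotientSubgroup ⊓ Subgroup.centralizer ({γ} : Set (quasiSplit F E c N).Adelic)).subgroupOf
        (Subgroup.centralizer ({γ} : Set (quasiSplit F E c N).Adelic)))]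
    [∀ γ : (quasiSplit F E c N).Adelic, BorelSpace (↥(Subgroup.centralizer ({γ} : Set (quasiSplit F E c N).Adelic)) ⧸
      ((quasiSplit F E c N).quotientSubgroup ⊓ Subgroup.centralizer ({γ} : Set (quasiSplit F E c N).Adelic)).subgroupOf
        (Subgroup.centralizer ({γ} : Set (quasiSplit F E c N).Adelic)))]
    [hL : IsClosed (((quasiSplit F E c N).quotientSubgroup : Set (quasiSplit F E c N).Adelic))]
    [hCcl : ∀ γ : (quasiSplit F E c N).Adelic, IsClosed ((Subgroup.centralizer ({γ} : Set (quasiSplit F E c N).Adelic) :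
      Subgroup (quasiSplit F E c N).Adelic) : Set (quasiSplit F E c N).Adelic)]
    [∀ γ : (quasiSplit F E c N).Adelic, (count : Measure ↥(((quasiSplit F E c N).quotientSubgroup ⊓
      Subgroup.centralizer ({γ} : Set (quasiSplit F E c N).Adelic)).subgroupOf
        (Subgroup.centralizer ({γ} : Set (quasiSplit F E c N).Adelic)))).IsHaarMeasure]
    [(count : Measure (quasiSplit F E c N).quotientSubgroup).IsHaarMeasure]
    [MeasurableSpace ((quasiSplit F E c N).Adelic ⧸ (quasiSplit F E c N).quotientSubgroup)]
    [BorelSpace ((quasiSplit F E c N).Adelic ⧸ (quasiSplit F E c N).quotientSubgroup)]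
    (μ : Measure ((quasiSplit F E c N).Adelic ⧸ (quasiSplit F E c N).quotientSubgroup))
    [SMulInvariantMeasure (quasiSplit F E c N).Adelic ((quasiSplit F E c N).Adelic ⧸ (quasiSplit F E c N).quotientSubgroup) μ]
    [IsFiniteMeasureOnCompacts μ] (hμ : μ ≠ 0)
    (ν : Measure (quasiSplit F E c N).Adelic) [IsHaarMeasure ν] [ν.IsMulRightInvariant]
    {cl : (quasiSplit F E c N).arithmeticSubgroup → ι} (hcl : IsConjInvariant cl) (i : ι)
    (rep : ConjClasses (quasiSplit F E c N).arithmeticSubgroup → (quasiSplit F E c N).arithmeticSubgroup)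
    (hrep : ∀ s, ConjClasses.mk (rep s) = s)
    (νC : ∀ s : {s : ConjClasses (quasiSplit F E c N).arithmeticSubgroup // cl (rep s) = i},
      Measure ↥(Subgroup.centralizer ({((rep s.1 : (quasiSplit F E c N).arithmeticSubgroup) : (quasiSplit F E c N).Adelic)} :
        Set (quasiSplit F E c N).Adelic)))
    [∀ s, IsHaarMeasure (νC s)] [∀ s, (νC s).IsMulRightInvariant] [∀ s, (νC s).IsInvInvariant]
    [hcpt : ∀ s : {s : ConjClasses (quasiSplit F E c N).arithmeticSubgroup // cl (rep s) = i},
      CompactSpace (↥(Subgroup.centralizer ({((rep s.1 : (quasiSplit F E c N).arithmeticSubgroup) :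
        (quasiSplit F E c N).Adelic)} : Set (quasiSplit F E c N).Adelic)) ⧸
        ((quasiSplit F E c N).quotientSubgroup ⊓ Subgroup.centralizer ({((rep s.1 : (quasiSplit F E c N).arithmeticSubgroup) :
          (quasiSplit F E c N).Adelic)} : Set (quasiSplit F E c N).Adelic)).subgroupOf
          (Subgroup.centralizer ({((rep s.1 : (quasiSplit F E c N).arithmeticSubgroup) : (quasiSplit F E c N).Adelic)} :
            Set (quasiSplit F E c N).Adelic)))]
    {f : (quasiSplit F E c N).Adelic → ℂ} (hf : Measurable f)
    (hfin : ∫⁻ x, conjTsum (quasiSplit F E c N).quotientSubgroup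
      (((↑) : (quasiSplit F E c N).arithmeticSubgroup → (quasiSplit F E c N).Adelic) '' (cl ⁻¹' {i}))
      (conj_mem_image_fiber hcl i) (fun g => (‖f g‖ₑ : ℝ≥0∞)) x ∂μ < ∞) :
    Integrable (conjTsum (quasiSplit F E c N).quotientSubgroup
      (((↑) : (quasiSplit F E c N).arithmeticSubgroup → (quasiSplit F E c N).Adelic) '' (cl ⁻¹' {i}))
      (conj_mem_image_fiber hcl i) f) μ ∧
    (∀ s : {s : ConjClasses (quasiSplit F E c N).arithmeticSubgroup // cl (rep s) = i},
      Integrable (descConj ((rep s.1 : (quasiSplit F E c N).arithmeticSubgroup) : (quasiSplit F E c N).Adelic)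
              (Subgroup.centralizer ({((rep s.1 : (quasiSplit F E c N).arithmeticSubgroup) : (quasiSplit F E c N).Adelic)} : Set (quasiSplit F E c N).Adelic))
              (fun _ hg => Subgroup.mem_centralizer_singleton_iff.1 hg) f) (quotientMeasure (Subgroup.centralizer ({((rep s.1 : (quasiSplit F E c N).arithmeticSubgroup) : (quasiSplit F E c N).Adelic)} : Set (quasiSplit F E c N).Adelic)) (νC s) (hCcl _) ν)) ∧
    Summable (fun s : {s : ConjClasses (quasiSplit F E c N).arithmeticSubgroup // cl (rep s) = i} =>
      (quotientMeasure (((quasiSplit F E c N).quotientSubgroup ⊓ Subgroup.centralizer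
              ({((rep s.1 : (quasiSplit F E c N).arithmeticSubgroup) : (quasiSplit F E c N).Adelic)} : Set (quasiSplit F E c N).Adelic)).subgroupOf
              (Subgroup.centralizer ({((rep s.1 : (quasiSplit F E c N).arithmeticSubgroup) : (quasiSplit F E c N).Adelic)} : Set (quasiSplit F E c N).Adelic))) count (isClosed_subgroupOf _ _ (hL.inter (hCcl _))) (νC s) Set.univ).toReal *
        ∫ y, ‖descConj ((rep s.1 : (quasiSplit F E c N).arithmeticSubgroup) : (quasiSplit F E c N).Adelic)
              (Subgroup.centralizer ({((rep s.1 : (quasiSplit F E c N).arithmeticSubgroup) : (quasiSplit F E c N).Adelic)} : Set (quasiSplit F E c N).Adelic))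
              (fun _ hg => Subgroup.mem_centralizer_singleton_iff.1 hg) f y‖ ∂quotientMeasure (Subgroup.centralizer ({((rep s.1 : (quasiSplit F E c N).arithmeticSubgroup) : (quasiSplit F E c N).Adelic)} : Set (quasiSplit F E c N).Adelic)) (νC s) (hCcl _) ν) ∧
    ∫ x, conjTsum (quasiSplit F E c N).quotientSubgroup
        (((↑) : (quasiSplit F E c N).arithmeticSubgroup → (quasiSplit F E c N).Adelic) '' (cl ⁻¹' {i}))
        (conj_mem_image_fiber hcl i) f x ∂μ =
      ((unfoldingConstant (quasiSplit F E c N).quotientSubgroup (count : Measure (quasiSplit F E c N).quotientSubgroup) μ ν : ℝ) : ℂ) *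
        ∑' s : {s : ConjClasses (quasiSplit F E c N).arithmeticSubgroup // cl (rep s) = i},
          ((quotientMeasure (((quasiSplit F E c N).quotientSubgroup ⊓ Subgroup.centralizer
              ({((rep s.1 : (quasiSplit F E c N).arithmeticSubgroup) : (quasiSplit F E c N).Adelic)} : Set (quasiSplit F E c N).Adelic)).subgroupOf
              (Subgroup.centralizer ({((rep s.1 : (quasiSplit F E c N).arithmeticSubgroup) : (quasiSplit F E c N).Adelic)} : Set (quasiSplit F E c N).Adelic))) count (isClosed_subgroupOf _ _ (hL.inter (hCcl _))) (νC s) Set.univ).toReal : ℂ) *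
            orbitalIntegral ((rep s.1 : (quasiSplit F E c N).arithmeticSubgroup) : (quasiSplit F E c N).Adelic) f (quotientMeasure (Subgroup.centralizer ({((rep s.1 : (quasiSplit F E c N).arithmeticSubgroup) : (quasiSplit F E c N).Adelic)} : Set (quasiSplit F E c N).Adelic)) (νC s) (hCcl _) ν) := by
  classical
  haveI : Countable (quasiSplit F E c N).arithmeticSubgroup := countable_arithmeticSubgroup_quasiSplit
  haveI : Countable ↥(((↑) : (quasiSplit F E c N).arithmeticSubgroup → (quasiSplit F E c N).Adelic) '' (cl ⁻¹' {i})) :=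
    ((Set.to_countable _).image _).to_subtype
  -- the `[0, ∞]`-identity with the constant inside the series
  have hId : ∀ Φ : (quasiSplit F E c N).Adelic → ℝ≥0∞, Measurable Φ →
      ∫⁻ x, conjTsum (quasiSplit F E c N).quotientSubgroup
        (((↑) : (quasiSplit F E c N).arithmeticSubgroup → (quasiSplit F E c N).Adelic) '' (cl ⁻¹' {i}))
        (conj_mem_image_fiber hcl i) Φ x ∂μ =
      ∑' s : {s : ConjClasses (quasiSplit F E c N).arithmeticSubgroup // cl (rep s) = i},
        ((unfoldingConstant (quasiSplit F E c N).quotientSubgroup (count : Measure (quasiSplit F E c N).quotientSubgroup) μ ν : ℝ≥0∞) *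
          quotientMeasure (((quasiSplit F E c N).quotientSubgroup ⊓ Subgroup.centralizer
              ({((rep s.1 : (quasiSplit F E c N).arithmeticSubgroup) : (quasiSplit F E c N).Adelic)} : Set (quasiSplit F E c N).Adelic)).subgroupOf
              (Subgroup.centralizer ({((rep s.1 : (quasiSplit F E c N).arithmeticSubgroup) : (quasiSplit F E c N).Adelic)} : Set (quasiSplit F E c N).Adelic))) count (isClosed_subgroupOf _ _ (hL.inter (hCcl _))) (νC s) Set.univ) *
        ∫⁻ y, descConj ((rep s.1 : (quasiSplit F E c N).arithmeticSubgroup) : (quasiSplit F E c N).Adelic)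
              (Subgroup.centralizer ({((rep s.1 : (quasiSplit F E c N).arithmeticSubgroup) : (quasiSplit F E c N).Adelic)} : Set (quasiSplit F E c N).Adelic))
              (fun _ hg => Subgroup.mem_centralizer_singleton_iff.1 hg) Φ y ∂quotientMeasure (Subgroup.centralizer ({((rep s.1 : (quasiSplit F E c N).arithmeticSubgroup) : (quasiSplit F E c N).Adelic)} : Set (quasiSplit F E c N).Adelic)) (νC s) (hCcl _) ν := by
    intro Φ hΦ
    rw [lintegral_conjTsum_fiber_eq_mul_tsum_covol_mul μ hμ ν hcl i rep hrep νC hΦ, ← ENNReal.tsum_mul_left]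
    exact tsum_congr fun s => by rw [mul_assoc]
  -- positivity of the constants
  have hρ0 : (count : Measure (quasiSplit F E c N).quotientSubgroup) ≠ 0 :=
    Measure.measure_univ_ne_zero.1 (isOpen_univ.measure_pos (count : Measure (quasiSplit F E c N).quotientSubgroup) ⟨1, trivial⟩).ne'
  have hc0 : 0 < unfoldingConstant (quasiSplit F E c N).quotientSubgroup (count : Measure (quasiSplit F E c N).quotientSubgroup) μ ν :=
    unfoldingConstant_pos (quasiSplit F E c N).quotientSubgroup count μ ν hμ hρ0
  have hd0 : ∀ s : {s : ConjClasses (quasiSplit F E c N).arithmeticSubgroup // cl (rep s) = i},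
      ((unfoldingConstant (quasiSplit F E c N).quotientSubgroup (count : Measure (quasiSplit F E c N).quotientSubgroup) μ ν : ℝ≥0∞) *
          quotientMeasure (((quasiSplit F E c N).quotientSubgroup ⊓ Subgroup.centralizer
              ({((rep s.1 : (quasiSplit F E c N).arithmeticSubgroup) : (quasiSplit F E c N).Adelic)} : Set (quasiSplit F E c N).Adelic)).subgroupOf
              (Subgroup.centralizer ({((rep s.1 : (quasiSplit F E c N).arithmeticSubgroup) : (quasiSplit F E c N).Adelic)} : Set (quasiSplit F E c N).Adelic))) count (isClosed_subgroupOf _ _ (hL.inter (hCcl _))) (νC s) Set.univ) ≠ 0 := fun s =>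
    mul_ne_zero (ENNReal.coe_ne_zero.2 hc0.ne') (Measure.measure_univ_ne_zero.2 (quotientMeasure_ne_zero _ _ _ (νC s)))
  obtain ⟨hint, hdesc, hsum, heq⟩ :=
    integral_conjTsum_eq_tsum_of_lintegral_complex (quasiSplit F E c N).quotientSubgroup
      (((↑) : (quasiSplit F E c N).arithmeticSubgroup → (quasiSplit F E c N).Adelic) '' (cl ⁻¹' {i}))
      (conj_mem_image_fiber hcl i) μ (fun s : {s : ConjClasses (quasiSplit F E c N).arithmeticSubgroup // cl (rep s) = i} => ((rep s.1 : (quasiSplit F E c N).arithmeticSubgroup) : (quasiSplit F E c N).Adelic))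
      (fun s => (Subgroup.centralizer ({((rep s.1 : (quasiSplit F E c N).arithmeticSubgroup) : (quasiSplit F E c N).Adelic)} : Set (quasiSplit F E c N).Adelic)))
      (fun s => fun _ hg => Subgroup.mem_centralizer_singleton_iff.1 hg)
      (fun s => quotientMeasure (Subgroup.centralizer ({((rep s.1 : (quasiSplit F E c N).arithmeticSubgroup) : (quasiSplit F E c N).Adelic)} : Set (quasiSplit F E c N).Adelic)) (νC s) (hCcl _) ν) hd0 hId hf hfin
  have htoReal : ∀ s : {s : ConjClasses (quasiSplit F E c N).arithmeticSubgroup // cl (rep s) = i},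
      (((unfoldingConstant (quasiSplit F E c N).quotientSubgroup (count : Measure (quasiSplit F E c N).quotientSubgroup) μ ν : ℝ≥0∞) *
          quotientMeasure (((quasiSplit F E c N).quotientSubgroup ⊓ Subgroup.centralizer
              ({((rep s.1 : (quasiSplit F E c N).arithmeticSubgroup) : (quasiSplit F E c N).Adelic)} : Set (quasiSplit F E c N).Adelic)).subgroupOf
              (Subgroup.centralizer ({((rep s.1 : (quasiSplit F E c N).arithmeticSubgroup) : (quasiSplit F E c N).Adelic)} : Set (quasiSplit F E c N).Adelic))) count (isClosed_subgroupOf _ _ (hL.inter (hCcl _))) (νC s) Set.univ)).toReal =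
      (unfoldingConstant (quasiSplit F E c N).quotientSubgroup (count : Measure (quasiSplit F E c N).quotientSubgroup) μ ν : ℝ) *
        (quotientMeasure (((quasiSplit F E c N).quotientSubgroup ⊓ Subgroup.centralizer
              ({((rep s.1 : (quasiSplit F E c N).arithmeticSubgroup) : (quasiSplit F E c N).Adelic)} : Set (quasiSplit F E c N).Adelic)).subgroupOf
              (Subgroup.centralizer ({((rep s.1 : (quasiSplit F E c N).arithmeticSubgroup) : (quasiSplit F E c N).Adelic)} : Set (quasiSplit F E c N).Adelic))) count (isClosed_subgroupOf _ _ (hL.inter (hCcl _))) (νC s) Set.univ).toReal := fun s => by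
    rw [ENNReal.toReal_mul, ENNReal.coe_toReal]
  refine ⟨hint, hdesc, ?_, ?_⟩
  · simp only [htoReal, mul_assoc] at hsum
    exact (summable_mul_left_iff (NNReal.coe_pos.2 hc0).ne').1 hsum
  · rw [heq, ← tsum_mul_left]
    refine tsum_congr fun s => ?_
    rw [htoReal, Complex.ofReal_mul, mul_assoc]
    rfl

/-! ## §5 Automorphic measures: `∫ K_𝔬(x,x)` and `J^T_𝔬(f)` for a class missing `B(F)` -/

/-- **`∫_{G(F)\G(𝔸_F)} K_𝔬(x, x) dμ(x) = c_μ · Σ'_{s ⊆ 𝔬} vol(G_{γ_s} ⧸ G(F)_{γ_s}) · O_{γ_s}^{ν/ν_s}(f)` for an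
AUTOMORPHIC measure `μ`** (§4 through the dictionary §1 `quotFun K_𝔬 = conjTsum G(F) 𝔬 f`; the automorphic quotient
carries its Borel structure ★ `AdelicGroupData.measurableSpaceQuotientForm`, keyed inline): integrability of the descended
diagonal class kernel, of the orbital integrands, absolute convergence, and the identity (Rogawski (1990), §2.3; Arthur
(1978), §8). [cite: Arthur1978TraceFormulaI, §8] [cite: Rogawski1990, §2.2 (p. 13)]
[cite: Gelbart1975, (9.13) and Thm. 9.22 (ii)] -/
theorem integral_quotFun_kernelClass_diag_eq_mul_tsum_covol_mul_orbitalIntegral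
    [T2Space (quasiSplit F E c N).Adelic] [LocallyCompactSpace (quasiSplit F E c N).Adelic]
    [SecondCountableTopology (quasiSplit F E c N).Adelic]
    [∀ γ : (quasiSplit F E c N).Adelic, MeasurableSpace ((quasiSplit F E c N).Adelic ⧸
      Subgroup.centralizer ({γ} : Set (quasiSplit F E c N).Adelic))]
    [∀ γ : (quasiSplit F E c N).Adelic, BorelSpace ((quasiSplit F E c N).Adelic ⧸
      Subgroup.centralizer ({γ} : Set (quasiSplit F E c N).Adelic))]
    [∀ γ : (quasiSplit F E c N).Adelic, MeasurableSpace (↥(Subgroup.centralizer ({γ} : Set (quasiSplit F E c N).Adelic)) ⧸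
      ((quasiSplit F E c N).quotientSubgroup ⊓ Subgroup.centralizer ({γ} : Set (quasiSplit F E c N).Adelic)).subgroupOf
        (Subgroup.centralizer ({γ} : Set (quasiSplit F E c N).Adelic)))]
    [∀ γ : (quasiSplit F E c N).Adelic, BorelSpace (↥(Subgroup.centralizer ({γ} : Set (quasiSplit F E c N).Adelic)) ⧸
      ((quasiSplit F E c N).quotientSubgroup ⊓ Subgroup.centralizer ({γ} : Set (quasiSplit F E c N).Adelic)).subgroupOf
        (Subgroup.centralizer ({γ} : Set (quasiSplit F E c N).Adelic)))]
    [hL : IsClosed (((quasiSplit F E c N).quotientSubgroup : Set (quasiSplit F E c N).Adelic))]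
    [hCcl : ∀ γ : (quasiSplit F E c N).Adelic, IsClosed ((Subgroup.centralizer ({γ} : Set (quasiSplit F E c N).Adelic) :
      Subgroup (quasiSplit F E c N).Adelic) : Set (quasiSplit F E c N).Adelic)]
    [∀ γ : (quasiSplit F E c N).Adelic, (count : Measure ↥(((quasiSplit F E c N).quotientSubgroup ⊓
      Subgroup.centralizer ({γ} : Set (quasiSplit F E c N).Adelic)).subgroupOf
        (Subgroup.centralizer ({γ} : Set (quasiSplit F E c N).Adelic)))).IsHaarMeasure]
    [(count : Measure (quasiSplit F E c N).quotientSubgroup).IsHaarMeasure]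
    (μ : Measure (quasiSplit F E c N).automorphicQuotient) [(quasiSplit F E c N).IsAutomorphicMeasure μ]
    (ν : Measure (quasiSplit F E c N).Adelic) [IsHaarMeasure ν] [ν.IsMulRightInvariant]
    {cl : (quasiSplit F E c N).arithmeticSubgroup → ι} (hcl : IsConjInvariant cl) (i : ι)
    (rep : ConjClasses (quasiSplit F E c N).arithmeticSubgroup → (quasiSplit F E c N).arithmeticSubgroup)
    (hrep : ∀ s, ConjClasses.mk (rep s) = s)
    (νC : ∀ s : {s : ConjClasses (quasiSplit F E c N).arithmeticSubgroup // cl (rep s) = i},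
      Measure ↥(Subgroup.centralizer ({((rep s.1 : (quasiSplit F E c N).arithmeticSubgroup) : (quasiSplit F E c N).Adelic)} :
        Set (quasiSplit F E c N).Adelic)))
    [∀ s, IsHaarMeasure (νC s)] [∀ s, (νC s).IsMulRightInvariant] [∀ s, (νC s).IsInvInvariant]
    [hcpt : ∀ s : {s : ConjClasses (quasiSplit F E c N).arithmeticSubgroup // cl (rep s) = i},
      CompactSpace (↥(Subgroup.centralizer ({((rep s.1 : (quasiSplit F E c N).arithmeticSubgroup) :
        (quasiSplit F E c N).Adelic)} : Set (quasiSplit F E c N).Adelic)) ⧸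
        ((quasiSplit F E c N).quotientSubgroup ⊓ Subgroup.centralizer ({((rep s.1 : (quasiSplit F E c N).arithmeticSubgroup) :
          (quasiSplit F E c N).Adelic)} : Set (quasiSplit F E c N).Adelic)).subgroupOf
          (Subgroup.centralizer ({((rep s.1 : (quasiSplit F E c N).arithmeticSubgroup) : (quasiSplit F E c N).Adelic)} :
            Set (quasiSplit F E c N).Adelic)))]
    {f : (quasiSplit F E c N).Adelic → ℂ} (hf : Measurable f)
    (hfin : ∫⁻ x, conjTsum (quasiSplit F E c N).quotientSubgroup
      (((↑) : (quasiSplit F E c N).arithmeticSubgroup → (quasiSplit F E c N).Adelic) '' (cl ⁻¹' {i}))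
      (conj_mem_image_fiber hcl i) (fun g => (‖f g‖ₑ : ℝ≥0∞)) x ∂μ < ∞) :
    letI := AdelicGroupData.measurableSpaceQuotientForm (quasiSplit F E c N)
    haveI := AdelicGroupData.borelSpaceQuotientForm (quasiSplit F E c N)
    haveI := AdelicGroupData.smulInvariantMeasureQuotientForm (quasiSplit F E c N) μ
    haveI := AdelicGroupData.isFiniteMeasureOnCompactsQuotientForm (quasiSplit F E c N) μ
    Integrable ((quasiSplit F E c N).quotFun (fun x => kernelClass cl i f x x)) μ ∧
    (∀ s : {s : ConjClasses (quasiSplit F E c N).arithmeticSubgroup // cl (rep s) = i},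
      Integrable (descConj ((rep s.1 : (quasiSplit F E c N).arithmeticSubgroup) : (quasiSplit F E c N).Adelic)
              (Subgroup.centralizer ({((rep s.1 : (quasiSplit F E c N).arithmeticSubgroup) : (quasiSplit F E c N).Adelic)} : Set (quasiSplit F E c N).Adelic))
              (fun _ hg => Subgroup.mem_centralizer_singleton_iff.1 hg) f) (quotientMeasure (Subgroup.centralizer ({((rep s.1 : (quasiSplit F E c N).arithmeticSubgroup) : (quasiSplit F E c N).Adelic)} : Set (quasiSplit F E c N).Adelic)) (νC s) (hCcl _) ν)) ∧
    Summable (fun s : {s : ConjClasses (quasiSplit F E c N).arithmeticSubgroup // cl (rep s) = i} =>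
      (quotientMeasure (((quasiSplit F E c N).quotientSubgroup ⊓ Subgroup.centralizer
              ({((rep s.1 : (quasiSplit F E c N).arithmeticSubgroup) : (quasiSplit F E c N).Adelic)} : Set (quasiSplit F E c N).Adelic)).subgroupOf
              (Subgroup.centralizer ({((rep s.1 : (quasiSplit F E c N).arithmeticSubgroup) : (quasiSplit F E c N).Adelic)} : Set (quasiSplit F E c N).Adelic))) count (isClosed_subgroupOf _ _ (hL.inter (hCcl _))) (νC s) Set.univ).toReal *
        ∫ y, ‖descConj ((rep s.1 : (quasiSplit F E c N).arithmeticSubgroup) : (quasiSplit F E c N).Adelic)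
              (Subgroup.centralizer ({((rep s.1 : (quasiSplit F E c N).arithmeticSubgroup) : (quasiSplit F E c N).Adelic)} : Set (quasiSplit F E c N).Adelic))
              (fun _ hg => Subgroup.mem_centralizer_singleton_iff.1 hg) f y‖ ∂quotientMeasure (Subgroup.centralizer ({((rep s.1 : (quasiSplit F E c N).arithmeticSubgroup) : (quasiSplit F E c N).Adelic)} : Set (quasiSplit F E c N).Adelic)) (νC s) (hCcl _) ν) ∧
    ∫ x, (quasiSplit F E c N).quotFun (fun x => kernelClass cl i f x x) x ∂μ =
      ((unfoldingConstant (quasiSplit F E c N).quotientSubgroup (count : Measure (quasiSplit F E c N).quotientSubgroup) μ ν : ℝ) : ℂ) *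
        ∑' s : {s : ConjClasses (quasiSplit F E c N).arithmeticSubgroup // cl (rep s) = i},
          ((quotientMeasure (((quasiSplit F E c N).quotientSubgroup ⊓ Subgroup.centralizer
              ({((rep s.1 : (quasiSplit F E c N).arithmeticSubgroup) : (quasiSplit F E c N).Adelic)} : Set (quasiSplit F E c N).Adelic)).subgroupOf
              (Subgroup.centralizer ({((rep s.1 : (quasiSplit F E c N).arithmeticSubgroup) : (quasiSplit F E c N).Adelic)} : Set (quasiSplit F E c N).Adelic))) count (isClosed_subgroupOf _ _ (hL.inter (hCcl _))) (νC s) Set.univ).toReal : ℂ) *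
            orbitalIntegral ((rep s.1 : (quasiSplit F E c N).arithmeticSubgroup) : (quasiSplit F E c N).Adelic) f (quotientMeasure (Subgroup.centralizer ({((rep s.1 : (quasiSplit F E c N).arithmeticSubgroup) : (quasiSplit F E c N).Adelic)} : Set (quasiSplit F E c N).Adelic)) (νC s) (hCcl _) ν) := by
  letI := AdelicGroupData.measurableSpaceQuotientForm (quasiSplit F E c N)
  haveI := AdelicGroupData.borelSpaceQuotientForm (quasiSplit F E c N)
  haveI := AdelicGroupData.smulInvariantMeasureQuotientForm (quasiSplit F E c N) μ
  haveI := AdelicGroupData.isFiniteMeasureOnCompactsQuotientForm (quasiSplit F E c N) μ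
  rw [quotFun_kernelClass_diag_eq_conjTsum hcl i f]
  exact integral_conjTsum_fiber_eq_mul_tsum_covol_mul_orbitalIntegral μ
    (AdelicGroupData.IsAutomorphicMeasure.ne_zero (quasiSplit F E c N) μ) ν hcl i rep hrep νC hf hfin

/-- **THE ELLIPTIC TERMS ARE ORBITAL INTEGRALS: `J^T_𝔬(f) = c_μ · Σ_{[γ] ⊆ 𝔬} vol(G_γ(F)\G_γ(𝔸_F)) · Φ_{ν/ν_γ}(γ, f)` for a
class `𝔬` missing the rational Borel `B(F)`**, for every cut-off `T`, every `ν₀`, `𝓕` and every automorphic `μ` (Rogawski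
(1990), §2.3 p. 14: the terms `J_𝔬(f)` for `𝔬` elliptic; Arthur (1978), §8) — (L4-a) ★
`truncatedTraceClass_eq_integral_kernelClass_of_forall_ne` (`k^T_𝔬 = K_𝔬` on the diagonal) + §5's unfolding; with it the
`μ`-integrability of the descended `k^T_𝔬`. The geometric inputs are the binders: `G_{γ_s} ⧸ G(F)_{γ_s}` compact ((L4-b) ★
`compactSpace_centralizer_quotient_of_forall_cl_ne`) and the finiteness `hfin` ((L4-e) ★ `lintegral_conjTsum_fiber_enorm_lt_top`).
[cite: Rogawski1990, §2.2 (p. 13)] [cite: Arthur1978TraceFormulaI, §8] [cite: Gelbart1975, (9.13) and Thm. 9.22 (ii)] -/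
theorem truncatedTraceClass_eq_mul_tsum_covol_mul_orbitalIntegral_of_forall_ne [NeZero N]
    [MeasurableSpace (adelicUnipotent F E c N)]
    [T2Space (quasiSplit F E c N).Adelic] [LocallyCompactSpace (quasiSplit F E c N).Adelic]
    [SecondCountableTopology (quasiSplit F E c N).Adelic]
    [∀ γ : (quasiSplit F E c N).Adelic, MeasurableSpace ((quasiSplit F E c N).Adelic ⧸
      Subgroup.centralizer ({γ} : Set (quasiSplit F E c N).Adelic))]
    [∀ γ : (quasiSplit F E c N).Adelic, BorelSpace ((quasiSplit F E c N).Adelic ⧸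
      Subgroup.centralizer ({γ} : Set (quasiSplit F E c N).Adelic))]
    [∀ γ : (quasiSplit F E c N).Adelic, MeasurableSpace (↥(Subgroup.centralizer ({γ} : Set (quasiSplit F E c N).Adelic)) ⧸
      ((quasiSplit F E c N).quotientSubgroup ⊓ Subgroup.centralizer ({γ} : Set (quasiSplit F E c N).Adelic)).subgroupOf
        (Subgroup.centralizer ({γ} : Set (quasiSplit F E c N).Adelic)))]
    [∀ γ : (quasiSplit F E c N).Adelic, BorelSpace (↥(Subgroup.centralizer ({γ} : Set (quasiSplit F E c N).Adelic)) ⧸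
      ((quasiSplit F E c N).quotientSubgroup ⊓ Subgroup.centralizer ({γ} : Set (quasiSplit F E c N).Adelic)).subgroupOf
        (Subgroup.centralizer ({γ} : Set (quasiSplit F E c N).Adelic)))]
    [hL : IsClosed (((quasiSplit F E c N).quotientSubgroup : Set (quasiSplit F E c N).Adelic))]
    [hCcl : ∀ γ : (quasiSplit F E c N).Adelic, IsClosed ((Subgroup.centralizer ({γ} : Set (quasiSplit F E c N).Adelic) :
      Subgroup (quasiSplit F E c N).Adelic) : Set (quasiSplit F E c N).Adelic)]
    [∀ γ : (quasiSplit F E c N).Adelic, (count : Measure ↥(((quasiSplit F E c N).quotientSubgroup ⊓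
      Subgroup.centralizer ({γ} : Set (quasiSplit F E c N).Adelic)).subgroupOf
        (Subgroup.centralizer ({γ} : Set (quasiSplit F E c N).Adelic)))).IsHaarMeasure]
    [(count : Measure (quasiSplit F E c N).quotientSubgroup).IsHaarMeasure]
    (μ : Measure (quasiSplit F E c N).automorphicQuotient) [(quasiSplit F E c N).IsAutomorphicMeasure μ]
    (ν : Measure (quasiSplit F E c N).Adelic) [IsHaarMeasure ν] [ν.IsMulRightInvariant]
    {cl : (quasiSplit F E c N).arithmeticSubgroup → ι} (hcl : IsConjInvariant cl) (i : ι)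
    (rep : ConjClasses (quasiSplit F E c N).arithmeticSubgroup → (quasiSplit F E c N).arithmeticSubgroup)
    (hrep : ∀ s, ConjClasses.mk (rep s) = s)
    (νC : ∀ s : {s : ConjClasses (quasiSplit F E c N).arithmeticSubgroup // cl (rep s) = i},
      Measure ↥(Subgroup.centralizer ({((rep s.1 : (quasiSplit F E c N).arithmeticSubgroup) : (quasiSplit F E c N).Adelic)} :
        Set (quasiSplit F E c N).Adelic)))
    [∀ s, IsHaarMeasure (νC s)] [∀ s, (νC s).IsMulRightInvariant] [∀ s, (νC s).IsInvInvariant]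
    [hcpt : ∀ s : {s : ConjClasses (quasiSplit F E c N).arithmeticSubgroup // cl (rep s) = i},
      CompactSpace (↥(Subgroup.centralizer ({((rep s.1 : (quasiSplit F E c N).arithmeticSubgroup) :
        (quasiSplit F E c N).Adelic)} : Set (quasiSplit F E c N).Adelic)) ⧸
        ((quasiSplit F E c N).quotientSubgroup ⊓ Subgroup.centralizer ({((rep s.1 : (quasiSplit F E c N).arithmeticSubgroup) :
          (quasiSplit F E c N).Adelic)} : Set (quasiSplit F E c N).Adelic)).subgroupOf
          (Subgroup.centralizer ({((rep s.1 : (quasiSplit F E c N).arithmeticSubgroup) : (quasiSplit F E c N).Adelic)} :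
            Set (quasiSplit F E c N).Adelic)))]
    (hi : ∀ β : arithmeticBorel F E c N, cl β ≠ i)
    {f : (quasiSplit F E c N).Adelic → ℂ} (hf : Measurable f)
    (hfin : ∫⁻ x, conjTsum (quasiSplit F E c N).quotientSubgroup
      (((↑) : (quasiSplit F E c N).arithmeticSubgroup → (quasiSplit F E c N).Adelic) '' (cl ⁻¹' {i}))
      (conj_mem_image_fiber hcl i) (fun g => (‖f g‖ₑ : ℝ≥0∞)) x ∂μ < ∞)
    (ν₀ : Measure (adelicUnipotent F E c N)) (𝓕 : Set (adelicUnipotent F E c N)) (T : ℝ≥0) :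
    letI := AdelicGroupData.measurableSpaceQuotientForm (quasiSplit F E c N)
    haveI := AdelicGroupData.borelSpaceQuotientForm (quasiSplit F E c N)
    haveI := AdelicGroupData.smulInvariantMeasureQuotientForm (quasiSplit F E c N) μ
    haveI := AdelicGroupData.isFiniteMeasureOnCompactsQuotientForm (quasiSplit F E c N) μ
    Integrable ((quasiSplit F E c N).quotFun (truncatedKernelClass ν₀ 𝓕 T cl i f)) μ ∧
    truncatedTraceClass μ ν₀ 𝓕 T cl i f =
      ((unfoldingConstant (quasiSplit F E c N).quotientSubgroup (count : Measure (quasiSplit F E c N).quotientSubgroup) μ ν : ℝ) : ℂ) *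
        ∑' s : {s : ConjClasses (quasiSplit F E c N).arithmeticSubgroup // cl (rep s) = i},
          ((quotientMeasure (((quasiSplit F E c N).quotientSubgroup ⊓ Subgroup.centralizer
              ({((rep s.1 : (quasiSplit F E c N).arithmeticSubgroup) : (quasiSplit F E c N).Adelic)} : Set (quasiSplit F E c N).Adelic)).subgroupOf
              (Subgroup.centralizer ({((rep s.1 : (quasiSplit F E c N).arithmeticSubgroup) : (quasiSplit F E c N).Adelic)} : Set (quasiSplit F E c N).Adelic))) count (isClosed_subgroupOf _ _ (hL.inter (hCcl _))) (νC s) Set.univ).toReal : ℂ) *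
            orbitalIntegral ((rep s.1 : (quasiSplit F E c N).arithmeticSubgroup) : (quasiSplit F E c N).Adelic) f (quotientMeasure (Subgroup.centralizer ({((rep s.1 : (quasiSplit F E c N).arithmeticSubgroup) : (quasiSplit F E c N).Adelic)} : Set (quasiSplit F E c N).Adelic)) (νC s) (hCcl _) ν) := by
  letI := AdelicGroupData.measurableSpaceQuotientForm (quasiSplit F E c N)
  haveI := AdelicGroupData.borelSpaceQuotientForm (quasiSplit F E c N)
  haveI := AdelicGroupData.smulInvariantMeasureQuotientForm (quasiSplit F E c N) μ
  haveI := AdelicGroupData.isFiniteMeasureOnCompactsQuotientForm (quasiSplit F E c N) μ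
  rw [integrable_quotFun_truncatedKernelClass_iff_of_forall_ne hi,
    truncatedTraceClass_eq_integral_kernelClass_of_forall_ne hi]
  obtain ⟨h1, -, -, h4⟩ := integral_quotFun_kernelClass_diag_eq_mul_tsum_covol_mul_orbitalIntegral μ ν hcl i rep
    hrep νC hf hfin
  exact ⟨h1, h4⟩

end Measure

end UnitaryGroup

end Literature.NumberTheory.Automorphic

end
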